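import Literature.NumberTheory.EllipticCurves.DeShalit1987.SplitPrimeMuVanishing
import Literature.NumberTheory.EllipticCurves.DeShalit1987.KatzMeasureMonomialLinesFrames
import Literature.NumberTheory.EllipticCurves.ZpExtensionSplitPrimeLineThroughPair
import HarnessLib

/-!
# Gillard's theorem read on the two-variable frame: the two-variable unit content
# (`thmIII212_exists_isUnit_coeff_katzMeasure₂`) for twists of type `(k, 0)` FOLLOWS from the one-variable
# theorem on the split-prime line (`thmIII212_hasUnitContent_katzBranch`) — proofs only

A *proofs* companion (theorems only; no definition, no named fact) of `SplitPrimeMuVanishing.lean`.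
That file carries two named facts: (G1) `thmIII212_hasUnitContent_katzBranch` — Gillard 1985 Thm. 2.9 /
de Shalit 1987 III.2.12 VERBATIM on the one-variable frame `IsKatzBranch` along a `ℤ_p`-quotient
unramified at `v̄` — and (G2) `thmIII212_exists_isUnit_coeff_katzMeasure₂`, its two-variable
transcription on `IsKatzMeasure₂`, whose docstring promised: "dischargeable modulo (G1) once the
restriction of `IsKatzMeasure₂` frames to sub-`ℤ_p`-lines is in the tree".  That restriction is now in
the tree (`KatzMeasureMonomialLines*.lean`: `IsKatzMeasure₂.isKatzBranch_monomialLine`), as is the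
split-prime line through any generator pair (`ZpExtensionSplitPrimeLineThroughPair.lean`:
`ZpExtension.exists_le_kerSubgroup_inertia_of_isTopGeneratorPair`).  This file draws the conclusion:

* `thmIII212_hasUnitContent_katzBranch.exists_isUnit_coeff_coeff` — GRANTED (G1): for `K` imaginary
  quadratic, `p ≥ 5` split (`v ≠ v̄`), any generator pair `(κ₁, κ₂; γ₁, γ₂)`, any twist `λ` ALGEBRAIC OF
  TYPE `(k, 0)` unramified off `S`, admissible periods, and any `G` in the two-variable frame
  `IsKatzMeasure₂ ι v v̄ S κ₁ κ₂ γ₁ γ₂ λ Ω δ Ω_p G`, SOME coefficient `[T₁^i T₂^n]G` is a unit: take the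
  split-prime line `κ` through the pair, a generator `γ`, restrict `G` to the monomial line
  `G((1+T)^{κ(γ₁)} − 1, (1+T)^{κ(γ₂)} − 1)` (a `λ`-twisted `κ`-branch at `γ`), apply (G1) to it, and lift
  its unit coefficient to `G` (`exists_isUnit_coeff_coeff_of_hasUnitContent_monomialLine`).
  This is (G2) restricted to `j = 0` — the case of the cell consumer
  (`Summit…CycTangentCM.TwoVarUnitContent`, twist `ψ_A⁻¹` of type `(−1, 0)`), which is thereby closed
  modulo the VERBATIM one-variable fact (G1) alone.  (The general `(k, j)` case of (G2) needs in addition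
  the parallel-line lemma after a unit twist; not done here.)

References: [Gillard1985] Thm. 2.9; [deShalit1987] III.1.11, III.2.12, II.4.17 (51)–(54);
[Schneps1987] Thm. IV.
-/

noncomputable section

open NumberField IsDedekindDomain Field
open Literature.NumberTheory.GaloisRepresentations
open Literature.NumberTheory.EllipticCurves.GreenbergVatsal2000

namespace Literature.NumberTheory.EllipticCurves.DeShalit1987

namespace thmIII212_hasUnitContent_katzBranch

/-- **Two-variable unit content for twists of type `(k, 0)`, GRANTED Gillard's one-variable theorem
(G1).** In the setting of `thmIII212_exists_isUnit_coeff_katzMeasure₂` with `j = 0`: some coefficient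
`[T₁^i T₂^n]G` of the two-variable frame `G` is a unit of `𝒪_{ℂ_p}`.  Proof: the split-prime `ℤ_p`-line
`κ` through the pair (`ZpExtension.exists_le_kerSubgroup_inertia_of_isTopGeneratorPair`, `p ≠ 2` as
`5 ≤ p`), a topological generator `γ` of it, the restriction of `G` to it
(`IsKatzMeasure₂.isKatzBranch_monomialLine`: a `λ`-twisted `κ`-branch), (G1) on that branch, and the
lift of a unit coefficient from a line through the origin to `G`.
[cite: deShalit1987, III.2.12 (p. 103) with II.4.17 (51)–(54) (p. 77–78)] [cite: Gillard1985, Thm. 2.9 (p. 87)] -/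
theorem exists_isUnit_coeff_coeff (h : thmIII212_hasUnitContent_katzBranch)
    (p : ℕ) [Fact p.Prime] (K : Type) [Field K] [NumberField K] (hp : 5 ≤ p) (hK : IsImaginaryQuadratic K)
    (ι : PadicAlgCl p ≃+* ℂ) (v vbar : HeightOneSpectrum (𝓞 K))
    (hv : ((p : ℕ) : 𝓞 K) ∈ v.asIdeal) (hvbar : ((p : ℕ) : 𝓞 K) ∈ vbar.asIdeal) (hne : vbar ≠ v)
    (hι : ∀ (w : InfinitePlace K) (k : 𝓞 K), k ∈ v.asIdeal ↔ ‖ι.symm (w.embedding (k : K))‖ < 1)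
    (S : Finset (HeightOneSpectrum (𝓞 K))) (hvS : v ∉ S) (hvbarS : vbar ∉ S)
    (κ₁ κ₂ : ZpExtension K p) (γ₁ γ₂ : absoluteGaloisGroup K)
    (hpair : ZpExtension.IsTopGeneratorPair κ₁ κ₂ γ₁ γ₂)
    (lam : HeckeCharacter K) (k : ℤ) (hlam : lam.HasInfinityType (fun _ ↦ k) (fun _ ↦ 0))
    (hunr : ∀ w : HeightOneSpectrum (𝓞 K), w ∉ S → lam.IsUnramifiedAt w)
    (Ω δ : ℂ) (Ωp : ℂ_[p]) (hΩ : Ω ≠ 0) (hΩp : Ωp ≠ 0)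
    (hδ : δ ^ 2 = (NumberField.discr K : ℂ) ∨ δ ^ 2 = -(NumberField.discr K : ℂ))
    (G : PowerSeries (PowerSeries (PadicComplexInt p)))
    (hG : IsKatzMeasure₂ ι v vbar S κ₁ κ₂ γ₁ γ₂ lam Ω δ Ωp G) :
    ∃ i n : ℕ, IsUnit (PowerSeries.coeff n (PowerSeries.coeff i G)) := by
  have hp2 : p ≠ 2 := by omega
  -- the split-prime line through the pair and a generator of it
  obtain ⟨κ, hκpair, hκinert⟩ :=
    ZpExtension.exists_le_kerSubgroup_inertia_of_isTopGeneratorPair hK hp2 hv hvbar hne hpair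
  obtain ⟨γ, hγ⟩ := κ.surjective (Multiplicative.ofAdd 1)
  have hγ' : κ.IsTopGenerator γ := hγ
  -- the restriction of `G` to that line is a `λ`-twisted `κ`-branch
  have hF := IsKatzMeasure₂.isKatzBranch_monomialLine hG hκpair hγ'
  -- Gillard on the branch, lifted to `G`
  have hunit := h p K hp hK ι v vbar hv hvbar hne hι S hvS hvbarS κ γ hκinert hγ' lam k hlam hunr Ω δ Ωp
    hΩ hΩp hδ _ hF
  exact IsKatzMeasure₂.exists_isUnit_coeff_coeff_of_hasUnitContent_monomialLine hunit

end thmIII212_hasUnitContent_katzBranch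

end Literature.NumberTheory.EllipticCurves.DeShalit1987
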